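import Summits.BirchSwinnertonDyer.BirchSwinnertonDyer.Theorems.UniversalToricDescentWildSplitWaldspurgerManinDisplay
import Summits.BirchSwinnertonDyer.Rank1Residual.X11b.IntSeriesValueRigidityOneSided
import Summits.BirchSwinnertonDyer.Rank1Residual.X11b.BDPRouteHsiehFrameSupplied
import Summits.BirchSwinnertonDyer.Rank1Residual.X11b.RouteR1LogOmega
import Summits.BirchSwinnertonDyer.Rank1Residual.X11b.EmbeddingDatumPrime
import Summits.BirchSwinnertonDyer.Rank1Residual.Partition.AnticyclotomicControlJSWEmbAt
import Summits.BirchSwinnertonDyer.Rank1Residual.Additive.PotSupersingularClasses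
import Literature.NumberTheory.EllipticCurves.Hsieh2014.AnticyclotomicPAdicLFunctionAnyLevel
import Literature.NumberTheory.EllipticCurves.ModularCurveManinConstantProofs
import Literature.NumberTheory.EllipticCurves.ManinConstantQuadraticTwistClassCertificate
import Literature.NumberTheory.QuadraticFields.KroneckerSplitting
import Literature.FieldTheory.AlgClosed.PadicAlgClEquivComplex
import HarnessLib

/-!
# Route `UniversalToricDescent` (W-ALL lane 3, wild `3`, rank one), crux #4 `WildSplitWaldspurgerAtThree`
# (stmt-BirchSwinnertonDyer-20385): its ♭-BODY — a BDP frame `Q ∈ 𝓞_{ℂ₃}⟦T⟧` for the datum's newform `Dt.f` at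
# the WILD prime `3` (`27 ∣ N`, `a₃ = 0`, Euler-type factor `1`) whose value at the trivial character is
# `u·(log_{ω_E} P / c)²` with `‖u‖ = 1` EXACTLY, the Manin constant `c = Dt.c` KEPT — from two refereed inputs

Prover seat `bsd-potss-kmc` (g19), cell `bsd-potss`, serving route `UniversalToricDescent` (cell `bsd-wall`, steward
`bsd-wall-pss3`), 2026-08-27. HONEST FRAMING: THEOREMS ONLY (0 definitions, 0 named facts, 0 `sorry`); every
statement is CONDITIONAL on the two displayed refereed inputs

* `hA : Hsieh2014.thmA_exists_isHsiehLFunction_unrPeriod_anyLevel` (Hsieh, Doc. Math. 19 (2014) Thm. A, typed at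
  every level: supplies the ♭-FRAME `Q ∈ 𝓞_{ℂ_p}⟦T⟧` with Castella's interpolation property `R1.IsBDPLFunctionInt`);
* `hL : LiuZhangZhang2018.thm151_thm153_modularCurve_heegnerVector_additive` (Liu–Zhang–Zhang, Duke Math. J. 167
  (2018) Thm 1.5.1 ∧ Thm 1.5.3 at a prime `p² ∣ N` split in `K`, p518041: supplies the VALUE at `𝟙`);

and BSD₃ is proved for no curve by any of this. Crux #4 AS TYPED asks for an `R₀`-frame (`L : UnrSeries 3`,
`IsBDPLFunction`, `u ∈ R₀ˣ`); what this file proves is its ♭-version (receptacle `𝓞_{ℂ₃}⟦T⟧`, `‖u‖ = 1`), i.e. crux #4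
MINUS the `R₀`-DESCENT `Q ↦ L ∈ R₀⟦T⟧`, which is not in print at `27 ∣ N` (Hsieh's receptacle is `Z̄_p⟦Γ⁻⟧`;
Castella–Hsieh 2018 Def. 3.5 / Castella 2018 Thm. 3.1 print `R₀`-coefficients only for `p ∤ N` / `N` square-free) —
the same diagnosis as bed-p2's «misstated by currency» on route `BiquadraticEisensteinDescent` (20195 → rev 8 ♭,
crux W♭ 20453 / 20325). The mathematics is bed-p2's `KatzWaldspurgerFrameCMInertBadFlatBody.frame_value_of_lzz`
(p522314) with four changes: `p = 3` (any odd `p` in §1–§2), NON-CM `W`, the Manin constant KEPT (no `p ∤ c` binder;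
the value is `u·(log_ω P / c)²`), and the datum's own form `Dt.f`.

## Contents (part 2; part 1 = `Theorems/UniversalToricDescentWildSplitWaldspurgerManinDisplay.lean`: the
## Manin-robust LZZ road `exists_exactDisplay_manin` / `exists_continuousDisplay_manin`)

* §2 **`intSeries_value_of_frame_manin`** — for EVERY ♭-frame `(Ω_K′, Ω_p′, Q′)` at `(ι′, 𝔭)` (any odd `p`,
  `p² ∣ N_W`, `d_K < −4`, Heegner hypothesis, `P` the Heegner point of the datum, of INFINITE order):
  `Q′(𝟙) = u·(log_ω P / c)²`, `‖u‖ = 1` — X11b's one-sided rigidity against the continuous display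
  (`X11b.intSeries_constantCoeff_eq_of_isBDPLFunctionInt_of_continuousValues`); **`exists_frameInt_value_manin`** —
  such a frame EXISTS (Hsieh any level + `X11b.lambdaSupplyAt` + `X11b.exists_isBDPLFunctionInt_of_isHsiehLFunction`).
* §3 **`wildSplitWaldspurgerAtThree_flat`** — the binders of crux #4 VERBATIM (`ClassO6 W 3`, `ρ̄₃` onto, `r_an = 1`,
  `N`, `K`, `Dt`, `H`, `ι`, `P`, Heegner hypothesis, `L(E^{(d_K)},1) ≠ 0`, `P` non-torsion, `κ`, `γ`, `𝔭` of degree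
  one) ⟹ `∃ ι′` inducing `𝔭` (= `SchneiderFree.BranchInducesPrime 3 ι′ 𝔭` unfolded) `∧ ∃ Ω_K ≠ 0, Ω_p ≠ 0,
  Q ∈ 𝓞_{ℂ₃}⟦T⟧` with `R1.IsBDPLFunctionInt 3 ι′ 𝔭 κ γ Dt.f Ω_K Ω_p Q ∧ ∃ u, ‖u‖ = 1 ∧ Q(𝟙) = u·(log_ω P/c)²`
  — the conclusion of crux #4 with `UnrSeries 3 ↦ PowerSeries 𝓞_ℂ_[3]`, `IsBDPLFunction ↦ R1.IsBDPLFunctionInt`,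
  `u : R₀ˣ ↦ ‖u‖ = 1`; plus **`wildSplitWaldspurgerAtThree_flat_forall`**: the value clause for EVERY ♭-frame at
  EVERY `ι′` inducing `𝔭`. Dictionary used: `ClassO6 W 3 ⟹ Addv ⟹ ¬ Good ∧ 9 ∣ N`; Heegner at `3 ∣ N` ⟹ `3`
  split ⟹ `(d_K/3) = 1` ⟹ `d_K ∉ {−3, −4}` ⟹ `d_K < −4` (`Quadratic.ncard_primesOver_eq_two_iff_jacobiSym`).

What this is NOT: not crux #4 as typed (no `R₀`-frame); not the unit `u ∈ R₀ˣ` (only `‖u‖ = 1` in `ℂ₃`); nothing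
about cruxes #2/#3 or the kernel; not a Literature filing; nothing booked.

References: [LiuZhangZhang2018] Duke Math. J. 167 (2018) Thm 1.5.1, Remark 1.1.2, Thm 1.5.3, (1.5), Rem 3.2.7;
[Hsieh2014] Doc. Math. 19 (2014) Thm. A; [Castella2018] Thms. 3.1–3.2 (shapes); [CaiShuTian2014] Prop 3.12;
[Collins2020] Thm 5; [Gross1984] §5; [Washington1997] §7.1; [EdixhovenManin1991] §1 (`c ≠ 0`).
-/

set_option autoImplicit false

-- D-0017 layout: summit = sub-problem, so `Summit.BirchSwinnertonDyer.BirchSwinnertonDyer.…` is the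
-- mandated namespace of Theorems files (same option as the route's sibling Theorems files).
set_option linter.dupNamespace false

noncomputable section

open scoped Classical MatrixGroups ModularForm Topology NumberField

namespace Summit.BirchSwinnertonDyer.BirchSwinnertonDyer.Theorems.UniversalToricDescentWaldspurgerFlat

open Filter CongruenceSubgroup WeierstrassCurve NumberField IsDedekindDomain Field PowerSeries
  Literature.NumberTheory.EllipticCurves Literature.NumberTheory.EllipticCurves.ModularForms
  Literature.NumberTheory.EllipticCurves.LiuZhangZhang2018 Literature.NumberTheory.EllipticCurves.Rank1Residual
  Literature.NumberTheory.GaloisRepresentations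
  Summit.BirchSwinnertonDyer.Rank1Residual Summit.BirchSwinnertonDyer.Rank1Residual.X11b
  Summit.BirchSwinnertonDyer.Rank1Residual.X11b.Halves Summit.BirchSwinnertonDyer.Rank1Residual.X2
  BiquadraticEisensteinDescentKatzWaldspurgerFrameCMInertBadFlatLZZRoad

/-! ### §2 The value of EVERY ♭-frame at the trivial character (any odd additive prime) -/

section Frame

variable {p : ℕ} [Fact p.Prime]

/-- **The value at `𝟙` of every ♭-frame at an additive prime, Manin constant kept.** For `W/ℚ` globally minimal
with bad ADDITIVE reduction at the odd prime `p` (`p² ∣ N_W`), `K` imaginary quadratic with `d_K < −4` satisfying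
the Heegner hypothesis for `N_W`, a Heegner datum `(Dt, H, ι_K, P)` with `P` of INFINITE order, `(κ, γ)`
anticyclotomic, a degree-one prime `𝔭 ∋ p`, an embedding datum `ι′` inducing `𝔭` and ANY form `f` that is a newform
of `W`: EVERY ♭-frame `(Ω_K′ ≠ 0, Ω_p′ ≠ 0, Q′ ∈ 𝓞_{ℂ_p}⟦T⟧)` with `R1.IsBDPLFunctionInt p ι′ 𝔭 κ γ f Ω_K′ Ω_p′ Q′`
has `Q′(𝟙) = u·(log_{ω_E} P / c)²` with `‖u‖ = 1` (`log` at `embAt K p 𝔭`) — the continuous display of §1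
transferred by X11b's one-sided rigidity (`X11b.intSeries_constantCoeff_eq_of_isBDPLFunctionInt_of_continuousValues`).
CONDITIONAL on the LZZ input `hL`; no `R₀`, CM, image or rank hypothesis.
[cite: LiuZhangZhang2018, Thm 1.5.1 and Thm 1.5.3 (Duke Math. J. 167 pp. 748–749)]
[cite: Castella2018, Thm. 3.1–3.2 (arXiv:1704.06608 pp. 8–9) (shapes)] -/
theorem intSeries_value_of_frame_manin
    (hL : thm151_thm153_modularCurve_heegnerVector_additive)
    (W : WeierstrassCurve ℚ) [W.IsElliptic] [W.IsGloballyMinimal]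
    (K : Type) [Field K] [NumberField K] (𝔭 : HeightOneSpectrum (𝓞 K))
    (κ : ZpExtension K p) (γ : absoluteGaloisGroup K) [Fact (κ.IsTopGenerator γ)] {N : ℕ} [NeZero N]
    (Dt : ModularParametrizationData W N) (H : HeegnerDatum N (NumberField.discr K))
    (ιK : K →+* ℂ) (P : (W.baseChange K).toAffine.Point)
    (f : CuspForm (CongruenceSubgroup.Gamma0 N) 2) (hfW : IsNewformOf W f)
    (hp2 : p ≠ 2) (hN : W.conductorNorm ℤ = N) (hp2N : p ^ 2 ∣ N) (hK : IsImaginaryQuadratic K)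
    (hd4 : NumberField.discr K < -4)
    (h𝔭 : ((p : ℕ) : 𝓞 K) ∈ 𝔭.asIdeal) (he : 𝔭.asIdeal.ramificationIdx (𝓞 ℚ) = 1)
    (hf : 𝔭.asIdeal.inertiaDeg (𝓞 ℚ) = 1)
    (hHN : SatisfiesHeegnerHypothesis N K) (hκ : κ.IsAnticyclotomic)
    (hP : WeierstrassCurve.Affine.Point.map ιK.toRatAlgHom P = heegnerPointComplex Dt H)
    (hPinf : ¬ IsOfFinAddOrder P)
    (ι' : PadicAlgCl p ≃+* ℂ)
    (hι' : ∀ (w : InfinitePlace K) (k : 𝓞 K), k ∈ 𝔭.asIdeal ↔ ‖ι'.symm (w.embedding (k : K))‖ < 1)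
    {ΩK' : ℂ} {Ωp' : ℂ_[p]} {Q' : PowerSeries (PadicComplexInt p)} (hΩK' : ΩK' ≠ 0) (hΩp' : Ωp' ≠ 0)
    (hQ' : R1.IsBDPLFunctionInt p ι' 𝔭 κ γ f ΩK' Ωp' Q') :
    ∃ u : ℂ_[p], ‖u‖ = 1 ∧ IntSeries.HasValueAt Q' 0
      (u * (algebraMap ℚ_[p] ℂ_[p] (logOmega W p (embAt K p 𝔭 h𝔭 he hf) P / (Dt.c : ℚ_[p]))) ^ 2) := by
  have hp : p.Prime := Fact.out
  have hγ : κ.IsTopGenerator γ := Fact.out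
  have hpN : p ∣ N := dvd_trans (dvd_pow_self p two_ne_zero) hp2N
  have hsplit : ((Ideal.span {(p : ℤ)}).primesOver (𝓞 K)).ncard = 2 := hHN p hp hpN
  set e : K →+* ℚ_[p] := embAt K p 𝔭 h𝔭 he hf with hedef
  have hemb : ∀ k : 𝓞 K, k ∈ 𝔭.asIdeal ↔ ‖e (k : K)‖ < 1 := mem_asIdeal_iff_norm_embAt_lt_one 𝔭 h𝔭 he hf
  -- the continuous display (LZZ road, Manin-robust) at the embedding of the frame's prime
  obtain ⟨Ωp₀, u, hΩp₀, hu, hcont⟩ :=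
    exists_continuousDisplay_manin hL ι' W K 𝔭 κ γ Dt H ιK e P f hp2 hN hp2N hK hd4 hsplit h𝔭 hι' hHN hκ hγ
      hfW hP hemb
  have hlog : Castella2018.padicLogOmega W p e P = logOmega W p e P := (R1.logOmega_eq_padicLogOmega W p e P).symm
  rw [hlog] at hcont
  -- the limit is non-zero: `P` of infinite order, `c ≠ 0`, `‖u‖ = 1`
  have hlogne : logOmega W p e P ≠ 0 := R1.logOmega_ne_zero W p e hPinf
  have hcZ : Dt.c ≠ 0 := Dt.maninConstant_ne_zero_holds
  have hcQ : (Dt.c : ℚ_[p]) ≠ 0 := by exact_mod_cast hcZ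
  have hu0 : u ≠ 0 := fun h0 ↦ by rw [h0, norm_zero] at hu; exact zero_ne_one hu
  have hc0 : u * (algebraMap ℚ_[p] ℂ_[p] (logOmega W p e P / (Dt.c : ℚ_[p]))) ^ 2 ≠ 0 :=
    mul_ne_zero hu0 (pow_ne_zero _ ((map_ne_zero _).mpr (div_ne_zero hlogne hcQ)))
  have heq := intSeries_constantCoeff_eq_of_isBDPLFunctionInt_of_continuousValues hp2 hK hκ hγ one_ne_zero
    hΩK' hΩp₀ hΩp' hcont hc0 hQ'
  refine ⟨u, hu, ?_⟩
  rw [← heq]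
  exact R1.intSeries_hasValueAt_zero p Q'

/-- **A ♭-frame EXISTS at every additive datum and has the value** (`∃`-form): for every embedding datum `ι′`
inducing `𝔭`, Hsieh 2014 Thm. A at any level (`hA`) gives `Ω_K ≠ 0`, `Ω_p ∈ R₀ˣ` and `Q ∈ 𝓞_{ℂ_p}⟦T⟧` with
`R1.IsBDPLFunctionInt p ι′ 𝔭 κ γ Dt.f Ω_K Ω_p Q` (λ-supply `X11b.lambdaSupplyAt`, glue
`X11b.exists_isBDPLFunctionInt_of_isHsiehLFunction`), and by `intSeries_value_of_frame_manin` its value at `𝟙` is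
`u·(log_ω P / c)²`, `‖u‖ = 1`. CONDITIONAL on `hA` and `hL`. [cite: Hsieh2014, Thm. A p. 712 (Doc. Math. 19) = Thm. 1 (arXiv:1112.1580 pp. 3–4)]
[cite: LiuZhangZhang2018, Thm 1.5.1 and Thm 1.5.3 (Duke Math. J. 167 pp. 748–749)] -/
theorem exists_frameInt_value_manin
    (hA : Hsieh2014.thmA_exists_isHsiehLFunction_unrPeriod_anyLevel)
    (hL : thm151_thm153_modularCurve_heegnerVector_additive)
    (W : WeierstrassCurve ℚ) [W.IsElliptic] [W.IsGloballyMinimal]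
    (K : Type) [Field K] [NumberField K] (𝔭 : HeightOneSpectrum (𝓞 K))
    (κ : ZpExtension K p) (γ : absoluteGaloisGroup K) [Fact (κ.IsTopGenerator γ)] {N : ℕ} [NeZero N]
    (Dt : ModularParametrizationData W N) (H : HeegnerDatum N (NumberField.discr K))
    (ιK : K →+* ℂ) (P : (W.baseChange K).toAffine.Point)
    (hp2 : p ≠ 2) (hN : W.conductorNorm ℤ = N) (hp2N : p ^ 2 ∣ N) (hK : IsImaginaryQuadratic K)
    (hd4 : NumberField.discr K < -4)
    (h𝔭 : ((p : ℕ) : 𝓞 K) ∈ 𝔭.asIdeal) (he : 𝔭.asIdeal.ramificationIdx (𝓞 ℚ) = 1)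
    (hf : 𝔭.asIdeal.inertiaDeg (𝓞 ℚ) = 1)
    (hHN : SatisfiesHeegnerHypothesis N K) (hκ : κ.IsAnticyclotomic)
    (hP : WeierstrassCurve.Affine.Point.map ιK.toRatAlgHom P = heegnerPointComplex Dt H)
    (hPinf : ¬ IsOfFinAddOrder P)
    (ι' : PadicAlgCl p ≃+* ℂ)
    (hι' : ∀ (w : InfinitePlace K) (k : 𝓞 K), k ∈ 𝔭.asIdeal ↔ ‖ι'.symm (w.embedding (k : K))‖ < 1) :
    ∃ (ΩK : ℂ) (Ωp : (unrIntegers p)ˣ) (Q : PowerSeries (PadicComplexInt p)), ΩK ≠ 0 ∧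
      R1.IsBDPLFunctionInt p ι' 𝔭 κ γ Dt.f ΩK ((Ωp : unrIntegers p) : ℂ_[p]) Q ∧
      ∃ u : ℂ_[p], ‖u‖ = 1 ∧ IntSeries.HasValueAt Q 0
        (u * (algebraMap ℚ_[p] ℂ_[p] (logOmega W p (embAt K p 𝔭 h𝔭 he hf) P / (Dt.c : ℚ_[p]))) ^ 2) := by
  have hp : p.Prime := Fact.out
  have hγ : κ.IsTopGenerator γ := Fact.out
  subst hN
  have hpN : p ∣ W.conductorNorm ℤ := dvd_trans (dvd_pow_self p two_ne_zero) hp2N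
  have hsplit : ((Ideal.span {(p : ℤ)}).primesOver (𝓞 K)).ncard = 2 := hHN p hp hpN
  -- the ♭-frame from the Hsieh input at `ι′`
  obtain ⟨lam, rlam, hunit, hinfl, hAQ, hunrl, havl, hfacl⟩ := lambdaSupplyAt hp2 ι' K κ hK hκ
  obtain ⟨A, ΩK₀, C, Ωp, Q₀, hA0, hΩK₀, hC, hQ₀⟩ :=
    hA ι' K 𝔭 κ γ Dt.f lam rlam hp2 Dt.isNewformOf.1 hK hsplit h𝔭 hι' hHN hunit hinfl hAQ hunrl havl hfacl
      hκ hγ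
  obtain ⟨ΩK, c, hΩK, -, hQ⟩ :=
    exists_isBDPLFunctionInt_of_isHsiehLFunction ι' 𝔭 κ γ Dt.f hpN hA0 hΩK₀ hC
      ((Ωp : unrIntegers p) : ℂ_[p]) hQ₀
  have hΩp : ((Ωp : unrIntegers p) : ℂ_[p]) ≠ 0 := fun h0 ↦ by
    have h1 := norm_coe_units_unrIntegers p Ωp
    rw [h0, norm_zero] at h1
    exact zero_ne_one h1
  refine ⟨ΩK, Ωp, _, hΩK, hQ, ?_⟩
  exact intSeries_value_of_frame_manin hL W K 𝔭 κ γ Dt H ιK P Dt.f Dt.isNewformOf hp2 rfl hp2N hK hd4 h𝔭 he hf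
    hHN hκ hP hPinf ι' hι' hΩK hΩp hQ

end Frame

/-! ### §3 Crux #4 of `UniversalToricDescent` in the ♭-receptacle (`p = 3`, the UTD binders verbatim) -/

section Three

/-- `(d_K / 3) = 1 ⟹ d_K < −4`: an imaginary quadratic field in which `3` splits has `d_K ∉ {−3, −4}`
(`3 ∣ −3`; `(−4/3) = (2/3) = −1`), hence `d_K ≤ −7`. [folklore] -/
theorem discr_lt_neg_four_of_three_split {K : Type} [Field K] [NumberField K] (hK : IsImaginaryQuadratic K)
    (hsplit : ((Ideal.span {((3 : ℕ) : ℤ)}).primesOver (𝓞 K)).ncard = 2) : NumberField.discr K < -4 := by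
  have hneg : NumberField.discr K < 0 := by
    haveI : IsTotallyComplex K := hK.2
    exact discr_neg_of_finrank_eq_two K hK.1
  have hj : jacobiSym (NumberField.discr K) 3 = 1 :=
    (Literature.NumberTheory.QuadraticFields.Quadratic.ncard_primesOver_eq_two_iff_jacobiSym hK.1
      Nat.prime_three (by norm_num)).mp hsplit
  have hmod4 := Literature.NumberTheory.QuadraticFields.Quadratic.discr_emod_four (K := K) hK.1
  have h3 : NumberField.discr K ≠ -3 := by
    intro h; rw [h] at hj; revert hj; norm_num [jacobiSym.mod_left]
  have h4 : NumberField.discr K ≠ -4 := by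
    intro h; rw [h] at hj; revert hj; norm_num [jacobiSym.mod_left]
  omega

/-- **Crux #4 `WildSplitWaldspurgerAtThree` of route `UniversalToricDescent` (stmt-BirchSwinnertonDyer-20385) in
the ♭-RECEPTACLE.** Over the crux's binders VERBATIM — `W/ℚ` globally minimal on the wild class at `3`
(`ClassO6 W 3`), `ρ̄_{E,3}` onto, `r_an = 1`, conductor `N`, `K` imaginary quadratic satisfying the Heegner
hypothesis for `N`, `Dt`, `H`, `ι`, the Heegner point `P` (non-torsion), `L(E^{(d_K)},1) ≠ 0`, `κ` anticyclotomic
with topological generator `γ`, `𝔭 ∋ 3` of degree one —: there is an embedding datum `ι′` inducing `𝔭` (the clause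
`SchneiderFree.BranchInducesPrime 3 ι′ 𝔭` unfolded) and a ♭-frame `(Ω_K ≠ 0, Ω_p ≠ 0, Q ∈ 𝓞_{ℂ₃}⟦T⟧)` for the
datum's newform `Dt.f` with `R1.IsBDPLFunctionInt 3 ι′ 𝔭 κ γ Dt.f Ω_K Ω_p Q` whose value at the trivial character
is `u·(log_{ω_E} P / c)²` with `‖u‖ = 1` — i.e. the crux's conclusion with `L : UnrSeries 3 ↦ Q : PowerSeries 𝓞_ℂ_[3]`,
`IsBDPLFunction ↦ R1.IsBDPLFunctionInt`, `u ∈ R₀ˣ ↦ ‖u‖ = 1`. The binders `ρ̄₃ onto`, `r_an = 1`,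
`L(E^{(d_K)},1) ≠ 0` are not used. CONDITIONAL on the two refereed inputs `hA`, `hL`; the `R₀`-descent of `Q` is
NOT claimed. [cite: Hsieh2014, Thm. A p. 712 (Doc. Math. 19)]
[cite: LiuZhangZhang2018, Thm 1.5.1 and Thm 1.5.3 (Duke Math. J. 167 pp. 748–749)] -/
theorem wildSplitWaldspurgerAtThree_flat
    (hA : Hsieh2014.thmA_exists_isHsiehLFunction_unrPeriod_anyLevel)
    (hL : thm151_thm153_modularCurve_heegnerVector_additive) :
    ∀ (W : WeierstrassCurve ℚ) [W.IsElliptic] [W.IsGloballyMinimal] (N : ℕ) [NeZero N] (K : Type) [Field K]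
      [NumberField K] (Dt : ModularParametrizationData W N) (H : HeegnerDatum N (NumberField.discr K))
      (ι : K →+* ℂ) (P : (W.baseChange K).toAffine.Point),
      Summit.BirchSwinnertonDyer.Rank1Residual.Additive.ClassO6 W 3 → W.HasSurjectiveModNGaloisRep 3 →
      W.analyticRank = 1 → W.conductorNorm ℤ = N → IsImaginaryQuadratic K → SatisfiesHeegnerHypothesis N K →
      (W.quadraticTwist (NumberField.discr K : ℚ)).entireLFunction 1 ≠ 0 →
      WeierstrassCurve.Affine.Point.map ι.toRatAlgHom P = heegnerPointComplex Dt H → ¬ IsOfFinAddOrder P →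
      ∀ (κ : ZpExtension K 3), κ.IsAnticyclotomic → ∀ (γ : Field.absoluteGaloisGroup K)
        [Fact (κ.IsTopGenerator γ)] (𝔭 : HeightOneSpectrum (𝓞 K)) (h𝔭 : ((3 : ℕ) : 𝓞 K) ∈ 𝔭.asIdeal)
        (he : 𝔭.asIdeal.ramificationIdx (𝓞 ℚ) = 1) (hf : 𝔭.asIdeal.inertiaDeg (𝓞 ℚ) = 1),
        ∃ ι' : PadicAlgCl 3 ≃+* ℂ,
          (∀ (w : InfinitePlace K) (k : 𝓞 K), k ∈ 𝔭.asIdeal ↔ ‖ι'.symm (w.embedding (k : K))‖ < 1) ∧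
          ∃ (ΩK : ℂ) (Ωp : ℂ_[3]) (Q : PowerSeries (PadicComplexInt 3)), ΩK ≠ 0 ∧ Ωp ≠ 0 ∧
            R1.IsBDPLFunctionInt 3 ι' 𝔭 κ γ Dt.f ΩK Ωp Q ∧
            ∃ u : ℂ_[3], ‖u‖ = 1 ∧ IntSeries.HasValueAt Q 0
              (u * (algebraMap ℚ_[3] ℂ_[3] (logOmega W 3 (embAt K 3 𝔭 h𝔭 he hf) P / (Dt.c : ℚ_[3]))) ^ 2) := by
  intro W _ _ N _ K _ _ Dt H ι P hO6 _ _ hN hK hHN _ hP hPinf κ hκ γ _ 𝔭 h𝔭 he hf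
  have hp : (3 : ℕ).Prime := Nat.prime_three
  -- the wild class is additive at `3`: `¬ good`, `9 ∣ N`
  have haddv : Addv W 3 := hO6.2.1
  have hbad : ¬ Good W 3 := haddv.1
  have hp2N : 3 ^ 2 ∣ N := by
    by_contra h
    rw [← hN] at h
    rcases hasGoodReductionAtPrime_or_hasMultiplicativeReductionAtPrime_of_not_sq_dvd_conductorNorm (V := W) h
      with hg | hm
    · exact haddv.1 hg
    · exact haddv.2 hm
  have hpN : 3 ∣ N := dvd_trans (dvd_pow_self 3 two_ne_zero) hp2N
  -- `3` splits in `K`, hence `d_K < −4`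
  have hsplit : ((Ideal.span {((3 : ℕ) : ℤ)}).primesOver (𝓞 K)).ncard = 2 := hHN 3 hp hpN
  have hd4 : NumberField.discr K < -4 := discr_lt_neg_four_of_three_split hK hsplit
  -- an embedding datum inducing `𝔭`
  obtain ⟨ι₀⟩ := PadicAlgCl.nonempty_ringEquiv_complex 3
  obtain ⟨ι', -, hι'⟩ := exists_datum_forall_mem_iff 3 ι₀ hK h𝔭
  obtain ⟨ΩK, Ωp, Q, hΩK, hQ, hval⟩ :=
    exists_frameInt_value_manin hA hL W K 𝔭 κ γ Dt H ι P (by norm_num) hN hp2N hK hd4 h𝔭 he hf hHN hκ hP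
      hPinf ι' hι'
  have hΩp : ((Ωp : unrIntegers 3) : ℂ_[3]) ≠ 0 := fun h0 ↦ by
    have h1 := norm_coe_units_unrIntegers 3 Ωp
    rw [h0, norm_zero] at h1
    exact zero_ne_one h1
  exact ⟨ι', hι', ΩK, _, Q, hΩK, hΩp, hQ, hval⟩

/-- **The value clause for EVERY ♭-frame at EVERY embedding datum inducing `𝔭`** (the form the kernel consumes:
crux #2's transported equality is a statement about ALL frames). Over the crux's binders, for every `ι′` inducing
`𝔭` and every ♭-frame `(Ω_K′ ≠ 0, Ω_p′ ≠ 0, Q′)` of `Dt.f` at `(ι′, 𝔭)`: `Q′(𝟙) = u·(log_{ω_E} P / c)²`,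
`‖u‖ = 1`. CONDITIONAL on `hL` only. [cite: LiuZhangZhang2018, Thm 1.5.1 and Thm 1.5.3 (Duke Math. J. 167 pp. 748–749)] -/
theorem wildSplitWaldspurgerAtThree_flat_forall
    (hL : thm151_thm153_modularCurve_heegnerVector_additive)
    (W : WeierstrassCurve ℚ) [W.IsElliptic] [W.IsGloballyMinimal] (N : ℕ) [NeZero N] (K : Type) [Field K]
    [NumberField K] (Dt : ModularParametrizationData W N) (H : HeegnerDatum N (NumberField.discr K))
    (ι : K →+* ℂ) (P : (W.baseChange K).toAffine.Point)
    (hO6 : Summit.BirchSwinnertonDyer.Rank1Residual.Additive.ClassO6 W 3) (hN : W.conductorNorm ℤ = N)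
    (hK : IsImaginaryQuadratic K) (hHN : SatisfiesHeegnerHypothesis N K)
    (hP : WeierstrassCurve.Affine.Point.map ι.toRatAlgHom P = heegnerPointComplex Dt H)
    (hPinf : ¬ IsOfFinAddOrder P) (κ : ZpExtension K 3) (hκ : κ.IsAnticyclotomic)
    (γ : Field.absoluteGaloisGroup K) [Fact (κ.IsTopGenerator γ)] (𝔭 : HeightOneSpectrum (𝓞 K))
    (h𝔭 : ((3 : ℕ) : 𝓞 K) ∈ 𝔭.asIdeal) (he : 𝔭.asIdeal.ramificationIdx (𝓞 ℚ) = 1)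
    (hf : 𝔭.asIdeal.inertiaDeg (𝓞 ℚ) = 1) (ι' : PadicAlgCl 3 ≃+* ℂ)
    (hι' : ∀ (w : InfinitePlace K) (k : 𝓞 K), k ∈ 𝔭.asIdeal ↔ ‖ι'.symm (w.embedding (k : K))‖ < 1)
    {ΩK' : ℂ} {Ωp' : ℂ_[3]} {Q' : PowerSeries (PadicComplexInt 3)} (hΩK' : ΩK' ≠ 0) (hΩp' : Ωp' ≠ 0)
    (hQ' : R1.IsBDPLFunctionInt 3 ι' 𝔭 κ γ Dt.f ΩK' Ωp' Q') :
    ∃ u : ℂ_[3], ‖u‖ = 1 ∧ IntSeries.HasValueAt Q' 0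
      (u * (algebraMap ℚ_[3] ℂ_[3] (logOmega W 3 (embAt K 3 𝔭 h𝔭 he hf) P / (Dt.c : ℚ_[3]))) ^ 2) := by
  have hp : (3 : ℕ).Prime := Nat.prime_three
  have haddv : Addv W 3 := hO6.2.1
  have hp2N : 3 ^ 2 ∣ N := by
    by_contra h
    rw [← hN] at h
    rcases hasGoodReductionAtPrime_or_hasMultiplicativeReductionAtPrime_of_not_sq_dvd_conductorNorm (V := W) h
      with hg | hm
    · exact haddv.1 hg
    · exact haddv.2 hm
  have hpN : 3 ∣ N := dvd_trans (dvd_pow_self 3 two_ne_zero) hp2N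
  have hsplit : ((Ideal.span {((3 : ℕ) : ℤ)}).primesOver (𝓞 K)).ncard = 2 := hHN 3 hp hpN
  have hd4 : NumberField.discr K < -4 := discr_lt_neg_four_of_three_split hK hsplit
  exact intSeries_value_of_frame_manin hL W K 𝔭 κ γ Dt H ι P Dt.f Dt.isNewformOf (by norm_num) hN hp2N hK hd4
    h𝔭 he hf hHN hκ hP hPinf ι' hι' hΩK' hΩp' hQ'

end Three

end Summit.BirchSwinnertonDyer.BirchSwinnertonDyer.Theorems.UniversalToricDescentWaldspurgerFlat

end
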